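import Summits.HodgeConjecture.HodgeConjecture.Theorems.F0LD2SameLabelLineClass
import Summits.HodgeConjecture.HodgeConjecture.Theorems.F0LD2SameLabelClassesOfLetters
import Summits.HodgeConjecture.HodgeConjecture.Theorems.F0LD2AutomorphicFinComponentUniqueOfCompact
import Literature.NumberTheory.Automorphic.Liu2021.LemD1RankTwoCMSameLabelLetter
import HarnessLib

/-!
# LD2 organ U₂″ `SameLabelClasses₂` CLOSED MODULO THE TWO Lem. D.1 LETTERS ONLY — «AFU» is no longer a hypothesis
# (★ `F0LD2AutomorphicFinComponentUniqueOfCompact.automorphicFinComponentUnique₂_of_posDef`, p849315, pays it at the CM curve frames)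

Cell `hodgecm-mathlib`, half A line LD2 (socket `stub_S1b_facts` of `Cruxes/HLiu418/Lines/F0_AlbCm`, books row #74; leaf
`Cruxes/HLiu418/Lines/F0_P6LD_StubS1bFactsOrganRoad.lean`), seat LD2-p02 (g2), 2026-09-02.  THEOREMS ONLY (no `def`, no named fact, no instance,
no `sorry`); `--supports stmt-HodgeConjecture-24832`.

* `sameLabelClasses₂_of_lemD1_letters (h4) (h1) : ‹SameLabelClasses₂›` — the organ text TOKEN FOR TOKEN (= the conclusion of ★
  `F0LD2SameLabelClassesOfLetters.sameLabelClasses₂_of_letters`, LD2-p01 (g0), p849053), with the «AFU» binder `hU` of that closer DISCHARGED: inside the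
  organ's Γ-prefix the frame carries `hsig₂ : ∀ τ′, mk τ′ ≠ mk ι → PosDef ((diag dV).map τ′)` and `hL : 4 ≤ [L:ℚ]`, so `[U(H)]` is compact and ★
  `automorphicFinComponentUnique₂_of_posDef L ι H dV hdV hdV0 t ht g hg hsig₂ hL μ : AutomorphicFinComponentUnique L⁺ L c̄ 2 H μ` replaces `hU L H dV … μ`;
  the rest of the proof is ★ p849053's verbatim (θ-carrier irreducible ∕ smooth ★ `isIrreducible_thetaCarrier₂` ∕ `isSmooth_thetaCarrier₂`, the
  `Representation.Equiv` read as an injective intertwiner ★ `injective_toIntertwiningMap`, then ★ E₂ `lineClassRigidity₂_of_letters h4 h1`).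
  SKELETON WIRING (LD2-plan's call): `stub_sameLabelClasses₂ := F0LD2SameLabelClassesOfAFUCompact.sameLabelClasses₂_of_lemD1_letters
  stub_letter_lemD14_nonsplit stub_letter_lemD11` and the letter stub `stub_letter_AFU₂` is RETIRED (leaf sorries 4 → 3: A₂ + {L4, L1}).

HONEST LABEL: HC_CM is proved only modulo the 7 printed citations (2 remaining: hLiu418 = stmt-HodgeConjecture-24832, h413 = stmt-HodgeConjecture-24833) until
rung 0 closes; this file moves no digit — it removes the letter «AFU» from the list #74R's in-house proof is conditional on.

## References
* [Liu2021] Y. Liu, Camb. J. Math. 9 (2021): Def. 4.11; proof of Prop. D.4 (1) (p. 131 L21–23); App. D Lem. D.1 (1), (4) (p. 125–126).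
* [BorelJacquet1979] A. Borel, H. Jacquet, PSPM 33.1 (1979), §4.6.  [FlathCorvallis1979] D. Flath, ibid., Thm. 3–4.
-/

set_option autoImplicit false
set_option linter.dupNamespace false

noncomputable section

open scoped Matrix ComplexOrder
open NumberField NumberField.InfinitePlace IsDedekindDomain MeasureTheory
open Literature.NumberTheory.Automorphic Literature.NumberTheory.Automorphic.UnitaryGroup
open Literature.NumberTheory.Automorphic.UnitaryCurveForms
open Literature.NumberTheory.Automorphic.Liu2021 Literature.NumberTheory.Automorphic.Liu2021.Def411WeilCarriers
open Literature.NumberTheory.Automorphic.Liu2021.Def411WeilCarriersDoubling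
open Literature.NumberTheory.Automorphic.Liu2021.LemD1RankTwoCMLetters
open Literature.NumberTheory.GaloisRepresentations Literature.NumberTheory.Automorphic.IdeleClassGroup
open Literature.NumberTheory.GelbartRogawski1991 Literature.NumberTheory.GelbartRogawski1991.UnitaryDualPair
open Literature.RepresentationTheory.Liu2021 Literature.RepresentationTheory.HarrisKudlaSweet1996
open Summit.HodgeConjecture.HodgeConjecture.Cruxes.HLiu418.F0LD2SameLabelLineClass
open Summit.HodgeConjecture.HodgeConjecture.Cruxes.HLiu418.F0LD2SameLabelClassesOfLetters
open Summit.HodgeConjecture.HodgeConjecture.Cruxes.HLiu418.F0LD2AutomorphicFinComponentUniqueOfCompact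

namespace Summit.HodgeConjecture.HodgeConjecture.Cruxes.HLiu418.F0LD2SameLabelClassesOfAFUCompact

/-- **U₂″ `SameLabelClasses₂` FROM THE TWO Lem. D.1 LETTERS ALONE** (the organ text token for token; «AFU» discharged at the compact CM curve frame by ★
`automorphicFinComponentUnique₂_of_posDef`, the rest = ★ `sameLabelClasses₂_of_letters` p849053 verbatim).
[cite: Liu2021, App. D, proof of Prop. D.4 (1) (p. 131 L21–23); Lem. D.1 (4), (1) (p. 125–126)] [cite: BorelJacquet1979, §4.6] [cite: FlathCorvallis1979, Thm. 3 and Thm. 4] -/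
theorem sameLabelClasses₂_of_lemD1_letters (h4 : LemD1_4AsPrintedNonsplitCM₂) (h1 : LemD1_1AsPrintedCM₂) :
  ∀ (L : Type) [Field L] [NumberField L] [IsCMField L] (ι : L →+* ℂ) (H : Matrix (Fin 2) (Fin 2) L)
    (dV : Fin 2 → L) (hdV : ∀ i, IsCMField.complexConj L (dV i) = dV i) (hdV0 : ∀ i, dV i ≠ 0)
    (t : L) (ht : t ≠ 0) (g : GL (Fin 2) L)
    (hg : formCongr ((IsCMField.complexConj L : L ≃ₐ[↥(maximalRealSubfield L)] L) : L →+* L) g (t • H) = Matrix.diagonal dV),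
    (∃ T : GL (Fin 2) ℂ, formCongr (starRingEnd ℂ) T ((Matrix.diagonal dV).map ι) = Matrix.diagonal ![(1 : ℂ), -1]) →
    (∀ τ' : L →+* ℂ, InfinitePlace.mk τ' ≠ InfinitePlace.mk ι → ((Matrix.diagonal dV).map τ').PosDef) →
    4 ≤ Module.finrank ℚ L →
    ∀ (𝔣 : ConeFrame L H (cmPlace L ι))
      (μ : Measure (adelicGroupData (↥(maximalRealSubfield L)) L (IsCMField.complexConj L) 2 H).automorphicQuotient)
      [(adelicGroupData (↥(maximalRealSubfield L)) L (IsCMField.complexConj L) 2 H).IsAutomorphicMeasure μ]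
      {n' : ℕ} (e₁ : Fin 2 × Fin 1 ≃ Fin n')
      (lam : Literature.NumberTheory.Automorphic.IdeleClassGroup L →ₜ* Circle) (hlam : IsConjugateSymplectic L lam), HasWeight L lam 1 →
    ∀ (a : (↥(maximalRealSubfield L))ˣ) (χ : Chi (↥(maximalRealSubfield L)) L (IsCMField.complexConj L))
      (W : Type) [AddCommGroup W] [Module ℂ W]
      (σ : Representation ℂ (finAdelic (↥(maximalRealSubfield L)) L (IsCMField.complexConj L) 2 H) W),
      σ.IsIrreducible → σ.IsSmooth →
    ∀ j : σ.IntertwiningMap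
        ((rhoVAtLine (↥(maximalRealSubfield L)) L (IsCMField.complexConj L) 2 e₁ (Matrix.diagonal dV)
            (complexConj_imagUnit L) (imagUnit_ne_zero L) (imagUnit_mul_self L) (realDiagonal_isSymm L dV hdV)
            (isUnit_det_realDiagonal L dV hdV hdV0) (realDiagonal_map L dV hdV).symm
            (fun a => isCompatible_chiSplittingLine L e₁ dV hdV hdV0 (toHeckeCharacter L lam)
              (isUnitary_toHeckeCharacter L lam) ((isOscillatorChar_toHeckeCharacter_iff lam).mpr hlam)
              (TW (↥(maximalRealSubfield L)) a) (isSymm_TW (↥(maximalRealSubfield L)) a)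
              (isUnit_det_TW (↥(maximalRealSubfield L)) a) (JW (↥(maximalRealSubfield L)) L a)
              (JW_eq (↥(maximalRealSubfield L)) L a)) a χ).comp
          (finAdelicCongr (↥(maximalRealSubfield L)) L (IsCMField.complexConj L) g ht hg).symm.toMonoidHom),
      Function.Injective j →
    ∀ P : DiscreteAutomorphicRep (adelicGroupData (↥(maximalRealSubfield L)) L (IsCMField.complexConj L) 2 H) μ,
      P.IsHolCotangentAt₂ (IsCMField.complexConj_ne_one L) (UnitaryGroup.complexConj_smul_infinitePlace L) (cmPlace L ι) 𝔣 →
      P.HasFinComponent σ →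
    ∀ (a' : (↥(maximalRealSubfield L))ˣ) (χ' : Chi (↥(maximalRealSubfield L)) L (IsCMField.complexConj L)),
      Nontrivial
        (omegaAtLine (↥(maximalRealSubfield L)) L (IsCMField.complexConj L) 2 e₁ (Matrix.diagonal dV)
            (complexConj_imagUnit L) (imagUnit_ne_zero L) (imagUnit_mul_self L) (realDiagonal_isSymm L dV hdV)
            (isUnit_det_realDiagonal L dV hdV hdV0) (realDiagonal_map L dV hdV).symm
            (fun a => isCompatible_chiSplittingLine L e₁ dV hdV hdV0 (toHeckeCharacter L lam)
              (isUnitary_toHeckeCharacter L lam) ((isOscillatorChar_toHeckeCharacter_iff lam).mpr hlam)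
              (TW (↥(maximalRealSubfield L)) a) (isSymm_TW (↥(maximalRealSubfield L)) a)
              (isUnit_det_TW (↥(maximalRealSubfield L)) a) (JW (↥(maximalRealSubfield L)) L a)
              (JW_eq (↥(maximalRealSubfield L)) L a)) a' χ') →
      P.HasFinComponent
          ((rhoVAtLine (↥(maximalRealSubfield L)) L (IsCMField.complexConj L) 2 e₁ (Matrix.diagonal dV)
              (complexConj_imagUnit L) (imagUnit_ne_zero L) (imagUnit_mul_self L) (realDiagonal_isSymm L dV hdV)
              (isUnit_det_realDiagonal L dV hdV hdV0) (realDiagonal_map L dV hdV).symm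
              (fun a => isCompatible_chiSplittingLine L e₁ dV hdV hdV0 (toHeckeCharacter L lam)
                (isUnitary_toHeckeCharacter L lam) ((isOscillatorChar_toHeckeCharacter_iff lam).mpr hlam)
                (TW (↥(maximalRealSubfield L)) a) (isSymm_TW (↥(maximalRealSubfield L)) a)
                (isUnit_det_TW (↥(maximalRealSubfield L)) a) (JW (↥(maximalRealSubfield L)) L a)
                (JW_eq (↥(maximalRealSubfield L)) L a)) a' χ').comp
            (finAdelicCongr (↥(maximalRealSubfield L)) L (IsCMField.complexConj L) g ht hg).symm.toMonoidHom) →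
      ∀ v : HeightOneSpectrum (𝓞 ↥(maximalRealSubfield L)),
        locF (↥(maximalRealSubfield L)) (imagUnitSq L) a' v = locF (↥(maximalRealSubfield L)) (imagUnitSq L) a v := by
  intro L _ _ _ ι H dV hdV hdV0 t ht g hg hsig₁ hsig₂ hL 𝔣 μ _ n' e₁ lam hlam hw a χ W _ _ σ hirr hsm j hj P hP hfin a' χ' hnt hfin' v
  -- «AFU» at the frame `(L⁺, L, c̄, 2, H, μ)` is now a THEOREM (compact quotient: `hsig₂`, `hL`): `σ ≅ ω(λ, ε_{a′}, χ′)_f ∘ congr⁻¹`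
  refine (automorphicFinComponentUnique₂_of_posDef L ι H dV hdV hdV0 t ht g hg hsig₂ hL μ P W σ _ _ hirr hsm
    (isIrreducible_thetaCarrier₂ L dV hdV hdV0 ht g hg e₁ lam hlam a' χ') (isSmooth_thetaCarrier₂ L dV hdV hdV0 ht g hg e₁ lam hlam a' χ')
    hfin hfin').elim fun e => ?_
  exact (lineClassRigidity₂_of_letters h4 h1 L ι H dV hdV hdV0 t ht g hg hsig₁ hsig₂ hL 𝔣 μ e₁ lam hlam hw a a' χ χ' W σ hirr hsm j hj
    e.toIntertwiningMap (injective_toIntertwiningMap e) v).symm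

/-! ## §2 (EDITION 2, ruling «U₂″-TRIM» = T2 after the «AFU» retirement) U₂″ modulo the ONE letter «R₂» ★ `LemD1_4SameLabelNonsplitCM₂` -/

/-- **U₂″ `SameLabelClasses₂` modulo «R₂» ALONE** (edition 2 of `sameLabelClasses₂_of_lemD1_letters`: the organ text TOKEN FOR TOKEN; «AFU» discharged by ★
`automorphicFinComponentUnique₂_of_posDef` exactly as in §1, and the two Lem. D.1 letters `h4`, `h1` replaced by the single same-label letter
`hR : LemD1_4SameLabelNonsplitCM₂` through ★ `F0LD2SameLabelLineClass.lineClassRigidity₂_of_sameLabel` (edition 2 of that file); since ★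
`F0LD2SameLabelRigidityOfLetters.lemD1_4SameLabelNonsplitCM₂_of_letters h4 h1 : LemD1_4SameLabelNonsplitCM₂`, this head is MONOTONE — weaker hypotheses, same
conclusion).  SKELETON WIRING (LD2-plan's call): `stub_sameLabelClasses₂ := F0LD2SameLabelClassesOfAFUCompact.sameLabelClasses₂_of_sameLabel stub_letter_R₂`
(U₂″'s letter list = {R₂}).  [cite: Liu2021, App. D, proof of Prop. D.4 (1) (p. 131 L21–23); Lem. D.1 (1), (4) (p. 125–126)] [cite: BorelJacquet1979, §4.6] -/
theorem sameLabelClasses₂_of_sameLabel (hR : LemD1_4SameLabelNonsplitCM₂) :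
  ∀ (L : Type) [Field L] [NumberField L] [IsCMField L] (ι : L →+* ℂ) (H : Matrix (Fin 2) (Fin 2) L)
    (dV : Fin 2 → L) (hdV : ∀ i, IsCMField.complexConj L (dV i) = dV i) (hdV0 : ∀ i, dV i ≠ 0)
    (t : L) (ht : t ≠ 0) (g : GL (Fin 2) L)
    (hg : formCongr ((IsCMField.complexConj L : L ≃ₐ[↥(maximalRealSubfield L)] L) : L →+* L) g (t • H) = Matrix.diagonal dV),
    (∃ T : GL (Fin 2) ℂ, formCongr (starRingEnd ℂ) T ((Matrix.diagonal dV).map ι) = Matrix.diagonal ![(1 : ℂ), -1]) →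
    (∀ τ' : L →+* ℂ, InfinitePlace.mk τ' ≠ InfinitePlace.mk ι → ((Matrix.diagonal dV).map τ').PosDef) →
    4 ≤ Module.finrank ℚ L →
    ∀ (𝔣 : ConeFrame L H (cmPlace L ι))
      (μ : Measure (adelicGroupData (↥(maximalRealSubfield L)) L (IsCMField.complexConj L) 2 H).automorphicQuotient)
      [(adelicGroupData (↥(maximalRealSubfield L)) L (IsCMField.complexConj L) 2 H).IsAutomorphicMeasure μ]
      {n' : ℕ} (e₁ : Fin 2 × Fin 1 ≃ Fin n')
      (lam : Literature.NumberTheory.Automorphic.IdeleClassGroup L →ₜ* Circle) (hlam : IsConjugateSymplectic L lam), HasWeight L lam 1 →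
    ∀ (a : (↥(maximalRealSubfield L))ˣ) (χ : Chi (↥(maximalRealSubfield L)) L (IsCMField.complexConj L))
      (W : Type) [AddCommGroup W] [Module ℂ W]
      (σ : Representation ℂ (finAdelic (↥(maximalRealSubfield L)) L (IsCMField.complexConj L) 2 H) W),
      σ.IsIrreducible → σ.IsSmooth →
    ∀ j : σ.IntertwiningMap
        ((rhoVAtLine (↥(maximalRealSubfield L)) L (IsCMField.complexConj L) 2 e₁ (Matrix.diagonal dV)
            (complexConj_imagUnit L) (imagUnit_ne_zero L) (imagUnit_mul_self L) (realDiagonal_isSymm L dV hdV)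
            (isUnit_det_realDiagonal L dV hdV hdV0) (realDiagonal_map L dV hdV).symm
            (fun a => isCompatible_chiSplittingLine L e₁ dV hdV hdV0 (toHeckeCharacter L lam)
              (isUnitary_toHeckeCharacter L lam) ((isOscillatorChar_toHeckeCharacter_iff lam).mpr hlam)
              (TW (↥(maximalRealSubfield L)) a) (isSymm_TW (↥(maximalRealSubfield L)) a)
              (isUnit_det_TW (↥(maximalRealSubfield L)) a) (JW (↥(maximalRealSubfield L)) L a)
              (JW_eq (↥(maximalRealSubfield L)) L a)) a χ).comp
          (finAdelicCongr (↥(maximalRealSubfield L)) L (IsCMField.complexConj L) g ht hg).symm.toMonoidHom),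
      Function.Injective j →
    ∀ P : DiscreteAutomorphicRep (adelicGroupData (↥(maximalRealSubfield L)) L (IsCMField.complexConj L) 2 H) μ,
      P.IsHolCotangentAt₂ (IsCMField.complexConj_ne_one L) (UnitaryGroup.complexConj_smul_infinitePlace L) (cmPlace L ι) 𝔣 →
      P.HasFinComponent σ →
    ∀ (a' : (↥(maximalRealSubfield L))ˣ) (χ' : Chi (↥(maximalRealSubfield L)) L (IsCMField.complexConj L)),
      Nontrivial
        (omegaAtLine (↥(maximalRealSubfield L)) L (IsCMField.complexConj L) 2 e₁ (Matrix.diagonal dV)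
            (complexConj_imagUnit L) (imagUnit_ne_zero L) (imagUnit_mul_self L) (realDiagonal_isSymm L dV hdV)
            (isUnit_det_realDiagonal L dV hdV hdV0) (realDiagonal_map L dV hdV).symm
            (fun a => isCompatible_chiSplittingLine L e₁ dV hdV hdV0 (toHeckeCharacter L lam)
              (isUnitary_toHeckeCharacter L lam) ((isOscillatorChar_toHeckeCharacter_iff lam).mpr hlam)
              (TW (↥(maximalRealSubfield L)) a) (isSymm_TW (↥(maximalRealSubfield L)) a)
              (isUnit_det_TW (↥(maximalRealSubfield L)) a) (JW (↥(maximalRealSubfield L)) L a)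
              (JW_eq (↥(maximalRealSubfield L)) L a)) a' χ') →
      P.HasFinComponent
          ((rhoVAtLine (↥(maximalRealSubfield L)) L (IsCMField.complexConj L) 2 e₁ (Matrix.diagonal dV)
              (complexConj_imagUnit L) (imagUnit_ne_zero L) (imagUnit_mul_self L) (realDiagonal_isSymm L dV hdV)
              (isUnit_det_realDiagonal L dV hdV hdV0) (realDiagonal_map L dV hdV).symm
              (fun a => isCompatible_chiSplittingLine L e₁ dV hdV hdV0 (toHeckeCharacter L lam)
                (isUnitary_toHeckeCharacter L lam) ((isOscillatorChar_toHeckeCharacter_iff lam).mpr hlam)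
                (TW (↥(maximalRealSubfield L)) a) (isSymm_TW (↥(maximalRealSubfield L)) a)
                (isUnit_det_TW (↥(maximalRealSubfield L)) a) (JW (↥(maximalRealSubfield L)) L a)
                (JW_eq (↥(maximalRealSubfield L)) L a)) a' χ').comp
            (finAdelicCongr (↥(maximalRealSubfield L)) L (IsCMField.complexConj L) g ht hg).symm.toMonoidHom) →
      ∀ v : HeightOneSpectrum (𝓞 ↥(maximalRealSubfield L)),
        locF (↥(maximalRealSubfield L)) (imagUnitSq L) a' v = locF (↥(maximalRealSubfield L)) (imagUnitSq L) a v := by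
  intro L _ _ _ ι H dV hdV hdV0 t ht g hg hsig₁ hsig₂ hL 𝔣 μ _ n' e₁ lam hlam hw a χ W _ _ σ hirr hsm j hj P hP hfin a' χ' hnt hfin' v
  -- «AFU» is the THEOREM ★ `automorphicFinComponentUnique₂_of_posDef` (compact quotient: `hsig₂`, `hL`); «R₂» replaces the two Lem. D.1 letters
  refine (automorphicFinComponentUnique₂_of_posDef L ι H dV hdV hdV0 t ht g hg hsig₂ hL μ P W σ _ _ hirr hsm
    (isIrreducible_thetaCarrier₂ L dV hdV hdV0 ht g hg e₁ lam hlam a' χ') (isSmooth_thetaCarrier₂ L dV hdV hdV0 ht g hg e₁ lam hlam a' χ')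
    hfin hfin').elim fun e => ?_
  exact (lineClassRigidity₂_of_sameLabel hR L ι H dV hdV hdV0 t ht g hg hsig₁ hsig₂ hL 𝔣 μ e₁ lam hlam hw a a' χ χ' W σ hirr hsm j hj
    e.toIntertwiningMap (injective_toIntertwiningMap e) v).symm


end Summit.HodgeConjecture.HodgeConjecture.Cruxes.HLiu418.F0LD2SameLabelClassesOfAFUCompact

end
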